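import Mathlib

/-!
# Stub `stub_liftDet` for crux `MatrixDescartes`, line `Lift`

The determinant identity of the PSD lift of a real lacunary matrix pencil.

Fix `K m : ℕ`, nonzero reals `γₗ` (`l : Fin K`), exponents `dₗ ≤ e` and real `m × m` matrices
`Sₗ`, and let `F(X) = ∑ₗ X^{dₗ} Sₗ` (an `m × m` matrix over `ℝ[X]`).  On the index type
`(Fin m × Fin K) ⊕ Fin m` consider the lifted pencil
`L(X) = X^e J + ∑ₗ X^{e-dₗ} (γₗ⁻¹ Eₗ ⊕ 0) + ∑ₗ X^{e+dₗ} (0 ⊕ (γₗ I - Sₗ))`, where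
`J = [[0, Wᵀ], [W, 0]]`, `W = [I | ⋯ | I] : m × (m · K)` (`W i (j, l) = [i = j]`) and `Eₗ` is the
diagonal projector onto the `l`-th copy of `Fin m`.  We prove (`stub_liftDet`) that
`det L = C a * X ^ M * det F` for some real `a ≠ 0` and some `M : ℕ`.

Route.  Writing `L = [[A, X^e Wᵀ], [X^e W, N]]` with the diagonal block
`A = diag (γₗ⁻¹ X^{e-dₗ})` and `N = ∑ₗ X^{e+dₗ} (γₗ I - Sₗ)`, and putting `D = diag (γₗ X^{dₗ})`
(so that `A D = D A = X^e I` and `W D Wᵀ = c I`, `c = ∑ₗ γₗ X^{dₗ}`), one has the block-unipotent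
factorisation `L = [[I, 0], [W D, I]] · [[A, 0], [0, N - X^e c I]] · [[I, D Wᵀ], [0, I]]`
(`fromBlocks_eq_unipotent_conj`, stated for an abstract such sextuple `A, D, W, N, x, c`), and
`N - X^e c I = -X^e F`; whence
`det L = det A · det (-X^e F) = C (∏ γₗ⁻¹) · X^{∑ (e-dₗ)} · (-1)^m X^{e m} det F`.
-/

set_option linter.dupNamespace false

namespace Summit.ValiantsHypothesis.ValiantsHypothesis.Theorems.LacunarySymmetroidMatrixDescartes

open Polynomial Matrix Finset
open scoped BigOperators

noncomputable section

/-! ## Abstract block bookkeeping -/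

/-- A finite sum of block matrices is the block matrix of the sums of the blocks. -/
theorem sum_fromBlocks {ι α : Type*} [AddCommMonoid α] {n p o q : Type*} (s : Finset ι)
    (A : ι → Matrix n p α) (B : ι → Matrix n q α) (C : ι → Matrix o p α)
    (D : ι → Matrix o q α) :
    ∑ i ∈ s, fromBlocks (A i) (B i) (C i) (D i) =
      fromBlocks (∑ i ∈ s, A i) (∑ i ∈ s, B i) (∑ i ∈ s, C i) (∑ i ∈ s, D i) := by
  ext (i | i) (j | j) <;> simp [Matrix.sum_apply]

/-- Block-unipotent factorisation: if `A D = D A = x I` and `W D Wᵀ = c I`, then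
`[[A, x Wᵀ], [x W, N]] = [[I, 0], [W D, I]] · [[A, 0], [0, N - x c I]] · [[I, D Wᵀ], [0, I]]`. -/
theorem fromBlocks_eq_unipotent_conj {n o R : Type*} [Fintype n] [Fintype o] [DecidableEq n]
    [DecidableEq o] [CommRing R] {A D : Matrix n n R} {W : Matrix o n R} {x c : R}
    (N : Matrix o o R) (hAD : A * D = x • (1 : Matrix n n R)) (hDA : D * A = x • (1 : Matrix n n R))
    (hW : W * D * Wᵀ = c • (1 : Matrix o o R)) :
    fromBlocks A (x • Wᵀ) (x • W) N =
      fromBlocks 1 0 (W * D) 1 * fromBlocks A 0 0 (N - (x * c) • (1 : Matrix o o R)) *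
        fromBlocks 1 (D * Wᵀ) 0 1 := by
  rw [fromBlocks_multiply, fromBlocks_multiply]
  simp only [Matrix.one_mul, Matrix.mul_one, Matrix.zero_mul, Matrix.mul_zero, add_zero,
    zero_add]
  rw [fromBlocks_inj]
  refine ⟨rfl, ?_, ?_, ?_⟩
  · rw [← Matrix.mul_assoc, hAD, Matrix.smul_mul, Matrix.one_mul]
  · rw [Matrix.mul_assoc, hDA, Matrix.mul_smul, Matrix.mul_one]
  · rw [Matrix.mul_assoc W, hDA, Matrix.mul_smul, Matrix.mul_one, Matrix.smul_mul,
      ← Matrix.mul_assoc, hW, smul_smul, add_sub_cancel]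

/-- Determinant of the lift shape: if `A D = D A = x I` and `W D Wᵀ = c I`, then
`det [[A, x Wᵀ], [x W, N]] = det A · det (N - x c I)`. -/
theorem det_fromBlocks_of_unipotent_conj {n o R : Type*} [Fintype n] [Fintype o] [DecidableEq n]
    [DecidableEq o] [CommRing R] {A D : Matrix n n R} {W : Matrix o n R} {x c : R}
    (N : Matrix o o R) (hAD : A * D = x • (1 : Matrix n n R)) (hDA : D * A = x • (1 : Matrix n n R))
    (hW : W * D * Wᵀ = c • (1 : Matrix o o R)) :
    (fromBlocks A (x • Wᵀ) (x • W) N).det = A.det * (N - (x * c) • (1 : Matrix o o R)).det := by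
  rw [fromBlocks_eq_unipotent_conj N hAD hDA hW]
  simp only [det_mul, det_fromBlocks_zero₁₂, det_fromBlocks_zero₂₁, det_one, one_mul, mul_one]

/-! ## The blocks of the lift -/

/-- The real block row `W = [I | ⋯ | I]` (`W i (j, l) = [i = j]`) mapped coefficientwise into
`ℝ[X]` is the same block row over `ℝ[X]`. -/
theorem of_blockRow_map_C (K m : ℕ) :
    (Matrix.of fun (i : Fin m) (jl : Fin m × Fin K) => if i = jl.1 then (1 : ℝ) else 0).map
        (C : ℝ → ℝ[X]) =
      Matrix.of fun (i : Fin m) (jl : Fin m × Fin K) => if i = jl.1 then (1 : ℝ[X]) else 0 := by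
  ext i jl
  simp only [map_apply, of_apply]
  split_ifs <;> simp

/-- For the block row `W = [I | ⋯ | I]`, `W · diag v · Wᵀ` is the diagonal matrix
`diag (i ↦ ∑ₗ v (i, l))`. -/
theorem blockRow_mul_diagonal_mul_transpose {K m : ℕ} {R : Type*} [CommSemiring R]
    (v : Fin m × Fin K → R) :
    (Matrix.of fun (i : Fin m) (jl : Fin m × Fin K) => if i = jl.1 then (1 : R) else 0) *
        diagonal v *
        (Matrix.of fun (i : Fin m) (jl : Fin m × Fin K) => if i = jl.1 then (1 : R) else 0)ᵀ =
      diagonal fun i => ∑ l, v (i, l) := by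
  ext i i'
  rw [mul_apply, Fintype.sum_prod_type_right]
  by_cases h : i = i'
  · subst h
    simp [mul_diagonal]
  · simp [mul_diagonal, h]

variable {K : ℕ} (m : ℕ) (γ : Fin K → ℝ) (d : Fin K → ℕ) (e : ℕ)

/-- `W D Wᵀ = (∑ₗ γₗ X^{dₗ}) I` for `D = diag ((j, l) ↦ γₗ X^{dₗ})`. -/
theorem blockRow_mul_liftD_mul_transpose :
    (Matrix.of fun (i : Fin m) (jl : Fin m × Fin K) => if i = jl.1 then (1 : ℝ[X]) else 0) *
        diagonal (fun jl : Fin m × Fin K => C (γ jl.2) * (X : ℝ[X]) ^ d jl.2) *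
        (Matrix.of fun (i : Fin m) (jl : Fin m × Fin K) => if i = jl.1 then (1 : ℝ[X]) else 0)ᵀ =
      (∑ l, C (γ l) * (X : ℝ[X]) ^ d l) • (1 : Matrix (Fin m) (Fin m) ℝ[X]) := by
  rw [blockRow_mul_diagonal_mul_transpose, smul_one_eq_diagonal]

/-- The top-left blocks `∑ₗ X^{e-dₗ} (γₗ⁻¹ Eₗ)` of the lift add up to the diagonal block
`A = diag ((j, l) ↦ γₗ⁻¹ X^{e-dₗ})`. -/
theorem sum_smul_diagonal_map_C :
    ∑ l : Fin K, (X : ℝ[X]) ^ (e - d l) •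
        (diagonal fun jl : Fin m × Fin K => if jl.2 = l then (γ l)⁻¹ else 0).map (C : ℝ → ℝ[X]) =
      diagonal fun jl : Fin m × Fin K => C (γ jl.2)⁻¹ * (X : ℝ[X]) ^ (e - d jl.2) := by
  refine Matrix.ext fun jl jl' => ?_
  simp only [Matrix.sum_apply, Matrix.smul_apply, Matrix.map_apply, smul_eq_mul]
  by_cases h : jl = jl'
  · subst h
    simp only [diagonal_apply_eq]
    rw [Finset.sum_eq_single_of_mem jl.2 (Finset.mem_univ _)
      (fun l _ hl => by rw [if_neg (Ne.symm hl), map_zero, mul_zero]), if_pos rfl, mul_comm]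
  · simp only [diagonal_apply_ne _ h, map_zero, mul_zero, Finset.sum_const_zero]

/-- `A D = X^e I` for `A = diag (γₗ⁻¹ X^{e-dₗ})`, `D = diag (γₗ X^{dₗ})` (`γₗ ≠ 0`, `dₗ ≤ e`). -/
theorem liftA_mul_liftD (hγ : ∀ l, γ l ≠ 0) (he : ∀ l, d l ≤ e) :
    diagonal (fun jl : Fin m × Fin K => C (γ jl.2)⁻¹ * (X : ℝ[X]) ^ (e - d jl.2)) *
        diagonal (fun jl : Fin m × Fin K => C (γ jl.2) * (X : ℝ[X]) ^ d jl.2) =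
      (X : ℝ[X]) ^ e • (1 : Matrix (Fin m × Fin K) (Fin m × Fin K) ℝ[X]) := by
  rw [diagonal_mul_diagonal, smul_one_eq_diagonal]
  congr 1
  funext jl
  rw [mul_mul_mul_comm, ← C_mul, inv_mul_cancel₀ (hγ _), C_1, one_mul, pow_sub_mul_pow _ (he _)]

/-- `D A = X^e I` for `A = diag (γₗ⁻¹ X^{e-dₗ})`, `D = diag (γₗ X^{dₗ})` (`γₗ ≠ 0`, `dₗ ≤ e`). -/
theorem liftD_mul_liftA (hγ : ∀ l, γ l ≠ 0) (he : ∀ l, d l ≤ e) :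
    diagonal (fun jl : Fin m × Fin K => C (γ jl.2) * (X : ℝ[X]) ^ d jl.2) *
        diagonal (fun jl : Fin m × Fin K => C (γ jl.2)⁻¹ * (X : ℝ[X]) ^ (e - d jl.2)) =
      (X : ℝ[X]) ^ e • (1 : Matrix (Fin m × Fin K) (Fin m × Fin K) ℝ[X]) := by
  rw [diagonal_mul_diagonal, smul_one_eq_diagonal]
  congr 1
  funext jl
  rw [mul_mul_mul_comm, ← C_mul, mul_inv_cancel₀ (hγ _), C_1, one_mul, pow_mul_pow_sub _ (he _)]

/-- `det A = C (∏ γₗ⁻¹) · X^{∑ (e - dₗ)}` (product and sum over `Fin m × Fin K`). -/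
theorem det_liftA :
    (diagonal fun jl : Fin m × Fin K => C (γ jl.2)⁻¹ * (X : ℝ[X]) ^ (e - d jl.2)).det =
      C (∏ jl : Fin m × Fin K, (γ jl.2)⁻¹) * (X : ℝ[X]) ^ (∑ jl : Fin m × Fin K, (e - d jl.2)) := by
  rw [det_diagonal, prod_mul_distrib, map_prod, prod_pow_eq_pow_sum]

/-- The Schur-complement block: `N - X^e (∑ₗ γₗ X^{dₗ}) I = -X^e F` for
`N = ∑ₗ X^{e+dₗ} (γₗ I - Sₗ)` and `F = ∑ₗ X^{dₗ} Sₗ`. -/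
theorem liftN_sub_smul_one (S : Fin K → Matrix (Fin m) (Fin m) ℝ) :
    ∑ l, (X : ℝ[X]) ^ (e + d l) • (γ l • (1 : Matrix (Fin m) (Fin m) ℝ) - S l).map (C : ℝ → ℝ[X]) -
        ((X : ℝ[X]) ^ e * ∑ l, C (γ l) * (X : ℝ[X]) ^ d l) • (1 : Matrix (Fin m) (Fin m) ℝ[X]) =
      -((X : ℝ[X]) ^ e • ∑ l, (X : ℝ[X]) ^ d l • (S l).map C) := by
  refine Matrix.ext fun i i' => ?_
  simp only [Matrix.sum_apply, Matrix.sub_apply, Matrix.neg_apply, Matrix.smul_apply,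
    Matrix.map_apply, smul_eq_mul, map_sub, map_mul]
  by_cases h : i = i'
  · subst h
    simp only [one_apply_eq, map_one, mul_one]
    rw [Finset.mul_sum, Finset.mul_sum, ← Finset.sum_sub_distrib, ← Finset.sum_neg_distrib]
    exact Finset.sum_congr rfl fun l _ => by ring
  · simp only [one_apply_ne h, map_zero, mul_zero, zero_sub, sub_zero]
    rw [Finset.mul_sum, ← Finset.sum_neg_distrib]
    exact Finset.sum_congr rfl fun l _ => by ring

/-! ## The lift identity -/

/-- **Lift identity** (`stub_liftDet`): with `W = [I | ⋯ | I] : m × (m·K)`, `J = [[0, Wᵀ], [W, 0]]`,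
`A = ∑ₗ X^{e-dₗ} γₗ⁻¹ Eₗ` (diagonal) and `N = ∑ₗ X^{e+dₗ} (γₗ I - Sₗ)`, the lifted pencil
`L = X^e J + (A ⊕ 0) + (0 ⊕ N)` satisfies `det L = C a · X^M · det F` for some real `a ≠ 0` and
`M : ℕ`, where `F = ∑ₗ X^{dₗ} Sₗ`; here `γₗ ≠ 0` and `dₗ ≤ e`.  (In fact
`a = (-1)^m ∏_{(j,l)} γₗ⁻¹` and `M = ∑_{(j,l)} (e - dₗ) + e m`.) -/
theorem stub_liftDet (K m : ℕ) (γ : Fin K → ℝ) (hγ : ∀ l, γ l ≠ 0) (d : Fin K → ℕ) (e : ℕ)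
    (he : ∀ l, d l ≤ e) (S : Fin K → Matrix (Fin m) (Fin m) ℝ) :
    ∃ (a : ℝ) (M : ℕ), a ≠ 0 ∧
      Matrix.det
        (((Polynomial.X : Polynomial ℝ) ^ e) •
            (Matrix.fromBlocks (0 : Matrix (Fin m × Fin K) (Fin m × Fin K) ℝ)
              (Matrix.of fun (i : Fin m) (jl : Fin m × Fin K) => if i = jl.1 then (1 : ℝ) else 0)ᵀ
              (Matrix.of fun (i : Fin m) (jl : Fin m × Fin K) => if i = jl.1 then (1 : ℝ) else 0)
              (0 : Matrix (Fin m) (Fin m) ℝ)).map Polynomial.C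
          + ∑ l : Fin K, ((Polynomial.X : Polynomial ℝ) ^ (e - d l)) •
            (Matrix.fromBlocks
              (Matrix.diagonal fun jl : Fin m × Fin K => if jl.2 = l then (γ l)⁻¹ else 0)
              0 0 (0 : Matrix (Fin m) (Fin m) ℝ)).map Polynomial.C
          + ∑ l : Fin K, ((Polynomial.X : Polynomial ℝ) ^ (e + d l)) •
            (Matrix.fromBlocks (0 : Matrix (Fin m × Fin K) (Fin m × Fin K) ℝ) 0 0
              (γ l • (1 : Matrix (Fin m) (Fin m) ℝ) - S l)).map Polynomial.C)
      = Polynomial.C a * (Polynomial.X : Polynomial ℝ) ^ M *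
          Matrix.det (∑ l, ((Polynomial.X : Polynomial ℝ) ^ d l) • (S l).map Polynomial.C) := by
  refine ⟨(-1) ^ m * ∏ jl : Fin m × Fin K, (γ jl.2)⁻¹, (∑ jl : Fin m × Fin K, (e - d jl.2)) + e * m,
    mul_ne_zero (pow_ne_zero _ (neg_ne_zero.mpr one_ne_zero))
      (prod_ne_zero_iff.mpr fun jl _ => inv_ne_zero (hγ jl.2)), ?_⟩
  -- the lift in block form `[[A, X^e Wᵀ], [X^e W, N]]`
  simp only [fromBlocks_map, transpose_map, Matrix.map_zero _ (Polynomial.C_0 (R := ℝ)),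
    fromBlocks_smul, smul_zero, sum_fromBlocks, Finset.sum_const_zero, fromBlocks_add, add_zero,
    zero_add, of_blockRow_map_C, sum_smul_diagonal_map_C]
  -- factorise, take determinants
  rw [det_fromBlocks_of_unipotent_conj _ (liftA_mul_liftD m γ d e hγ he)
      (liftD_mul_liftA m γ d e hγ he) (blockRow_mul_liftD_mul_transpose m γ d),
    liftN_sub_smul_one, det_neg, det_smul, det_liftA, Fintype.card_fin]
  simp only [map_mul, map_pow, map_neg, map_one]
  ring

end

end Summit.ValiantsHypothesis.ValiantsHypothesis.Theorems.LacunarySymmetroidMatrixDescartes
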